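import Summits.QuantumFields.BalabanUV.T4Continuum.Spine.NE1p.DressedSmallFieldCoresMassWitness

/-!
# T⁴ programme, spine estimate NE1′ (node O3b/H2) — WITNESS «THE DRESSING CURVE NEED NOT BE A PENCIL»: the owner's CURVE-FORM cores END
# `attachedPart_locE_le_of_cores_mass` (N0q `DressedSmallFieldOnCoresMass` §2 — ZERO appliers in the tree before this file) APPLIED ONCE BY
# NAME on W33's live (2.14)-core of the FORMAT of record along the DECIDED NON-AFFINE holomorphic table curve `s ↦ 0 + (s²∕2) • liveTable`;
# IN KERNEL the curve is NO pencil; the bounded quantity is NOT zero; its `hL3`-twin N0p §4 `attachedPart_locE_le_of_cores` fires on the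
# same curve; LOCATED: the curve-form ENDs charge (B3)'s read-out growth letter at the SUP of the curve over the disc, not at its endpoint

Cell `pub-balaban`, sub-cell `t4`, BINDER-OWNERS row NE1′ (owner lineage t4-ne1p-p1), crew `b2b-balaban-t4-ne1p-formalise-*`, seat `…-leaf-06`
(LEAF PROVER 06, gen 10; lineage S7∕S8∕S7b∕S7c∕W4s∕W22∕W26∕W31∕W36); crew WITNESS row **W44** ∕ DAG N29zzc (`t4/formal/NE1p/LEAVES.md`; INTENT
`HOME/CLAIMS.log` l.18402, 2026-08-20T17:32Z; BOOKED typer R-T123 (iv) l.18500 — definition lane, no width slot; cross-read X145).  ADDITIVE —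
imports W35 `Spine/NE1p/DressedSmallFieldCoresMassWitness` (leaf-09-g10, p227597: `cM`, `actM`, `hM3_M`, `letterMass_coreW`,
`coresMuEnd_live`) ONLY — through it the owner's N0q `DressedSmallFieldOnCoresMass` (p226475:
`attachedPart_locE_le_of_cores_mass`) and N0p `DressedSmallFieldOnCores` (p224732: `attachedPart_locE_le_of_cores`), W33
`DressedSmallFieldCoresWitness` (p225894: `liveTable`, `coreW`∕`coreFam`, `ctr0`∕`hroom0`, `Acst`, `cW`, `termsW`, `actW`, `hL3_W`,
`hsmall_W`, `termBi_coreFam`, `incr`, `integrable_term`, `norm_actW_X₀_lt_one`), W24 `DressedSmallFieldTorusWitness` (`X₀`, `hrate_torus`,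
`exp_locE_cube`), row NE5's `B13HistWitness.toyFrame` and row O1-c's `B13HistReadout.VppCLMM`; TWO toy DATA `def`s (`hcQ`, `actQ`) +
theorems; 0 `def … : Prop`, 0 cite, no proof placeholder; nothing of N0q ∕ N0p ∕ W33 ∕ W35 ∕ W24 ∕ rows NE5 ∕ O1-c is restated —
their declarations are used BY NAME.

WHY.  N0p §4 states its cores END for an ARBITRARY holomorphic dressing curve `hc : ℂ → B13HistM P` on the disc `‖s‖ < ϱ`
(`attachedPart_locE_le_of_cores`: `hcurve`, class membership `hK` ALONG THE CURVE, table radius `hR : ‖hc s‖ ≤ R₀`, (B3) `hL3` read at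
the growth radius `R₀`), and N0q §2 re-reads (B3) there as a LETTER budget (`attachedPart_locE_le_of_cores_mass`, `hL3 ↦ hM3`).  In the
145-module tree N0q's curve-form END had NO applier at all (its pencil sibling `…_cores_pencil_mass` has W35 ∕ S28 ∕ N0r; `grep`), and EVERY
`hc :=` instantiated anywhere in a curve-form END is AFFINE — N0p's own pencil corollary `h₀ + s • w`, N0r §2 (`h₀ + s • w` ∕ `h₀ + s • v`),
W31 (`s * w₀`), W35 (`0 + s • liveTable`): the curve generality of N0p §3∕§4 and N0q §2∕§3 had no non-affine inhabitant.  THIS FILE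
supplies one and LOCATES what the curve form charges:
* §1 the decided curve `hcQ s := 0 + (s²∕2) • liveTable` (W33's live table `V″ = e^{−φ²}`): entire; on `‖s‖ < 2` of table radius
  `‖hcQ s‖ ≤ 2‖liveTable‖ ≤ 2` — it stays in row NE5's ball class of history radius `2` and within W35's growth radius `R₀ = ‖0‖ +
  2‖liveTable‖` EXACTLY as W35's pencil does; the activity `actQ` = the sum of W33's core terms at W35's weight `cM r` with the table
  `hcQ s` (BY DEFINITION — `hact`∕`hscale` by `rfl`), `= actM (s²∕2)` by `rfl`, so `actQ 1 = actM ½`, `actQ 0 = actM 0`;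
* §2 **`curveEnd_fires`** = N0q `attachedPart_locE_le_of_cores_mass (tsys 4 N) (tgeometry 4 N) (coreFam (cM r) r hr)` ONCE BY NAME with
  `hc := hcQ`, `hcurve := differentiable_hcQ`, `hK`∕`hR` from §1, NE5's toy letters `(mq, bq, N₀) = (1, 0, 1)` INLINE in the literal
  binder shapes (W33∕W35 pattern), W33's `hroom0`∕`ctr0`∕`hsmall_W`, W24's `hrate_torus`, W35's `hM3_M` UNCHANGED (the curve has the
  pencil's growth radius), `hϱ : 2 ≤ 2`, `hϱA`; conclusion LITERAL, closed form `≤ 2·K₀(64,8)` (`curveEnd_fires_closed`);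
* §3 IN KERNEL **`hcQ_not_pencil : ¬ ∃ h₀ w, ∀ s ∈ ball 0 2, hcQ s = h₀ + s • w`** — read the would-be identity through row O1-c's bounded
  linear functional `VppCLMM toyFrame 0 0` (`liveTable ↦ e⁰ = 1`, W33 `VppM_liveTable`) at `s = 0, 1, −1`: `½ = a + b`, `½ = a − b`,
  `0 = a` ⇒ `1 = 0` (`linear_combination`); `liveTable_ne_zero` likewise; so NONE of the pencil ENDs (N0p `…_cores_pencil`, N0q
  `…_cores_pencil_mass`, N0r §2∕§3) can state §2's inequality — only the curve form can;
* §4 GENUINE **`curveEnd_live`**: the bounded quantity is NOT zero — W35's `coresMuEnd_live` at the REAL source `t = ½` BY NAME (the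
  curve's endpoint is the HALF-strength table `½ • liveTable`; W24's `exp_locE_cube` inside);
* §5 LOCATED (arithmetic): **`letterClause_iff`** — at W35's weight `cM r = A·e^{−2r}∕√(2π)` on W33's core the (B3) letter clause with
  growth radius `R₀`, `|cM r|·√(2π)·e^{r·R₀} ≤ A`, holds IFF `R₀ ≤ 2`; **`norm_hcQ_sharp`** — the curve's radius bound `2‖liveTable‖` is
  SHARP on the disc although the END compares only the endpoint tables `hcQ 1 = ½ • liveTable`, `hcQ 0 = 0`: N0q's `hR`∕`hM3` read the
  growth letter `e^{N₁R₀}` at `R₀ ≥ sup_{‖s‖<ϱ} ‖hc s‖` over the WHOLE disc (`ϱ ≥ 2` forced by N0m's `hϱ`), so with the pencil's budget a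
  curved dressing reaches table strength `½`, not `1`; **`fullCurve_exceeds_radius`** — the full-strength curve `s ↦ 0 + s² • liveTable`
  (endpoint `liveTable`, as the pencil) leaves the radius `‖0‖ + 2‖liveTable‖` inside the disc (at `s = 3∕2`: `(9∕4)‖liveTable‖`), so `hR`
  at W35's growth radius FAILS for it (mutant M1); by `letterClause_iff` its growth radius `4` needs the weight `e^{−4r}`-small, i.e. W35's
  `cM (2r)` — SAID, not built;
* §6 the `hL3`-TWIN **`curveEndExact_fires`** = N0p §4 `attachedPart_locE_le_of_cores (coreFam (cW r) r hr)` ONCE BY NAME on the SAME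
  curve at W33's exact-mass weight `cW r` with W33's `hL3_W` UNCHANGED, the activity being W33's own `actW` read at `s²∕2` (no new datum);
  GENUINE **`curveEndExact_live`** via `actW_real_sub_zero` ∕
  `actW_real_live` (W35's `actM_real_sub_zero` replayed at W33's weight — W33 states `t = 1` only) at `t = ½`, W24's `exp_locE_cube` and
  W33's `norm_actW_X₀_lt_one` BY NAME.

WORDING OF RECORD (crew row W44 = DAG N29zzc, typer R-T123 (iv) (g): the holder's title sentence of l.18402 ACCEPTED + the typer's rider, ADOPTED
VERBATIM): «OUR decided holomorphic table curve over row NE5's toy frame at W35's CHOSEN weight; the curve-form END's generality (`hcurve :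
DifferentiableOn ℂ hc (ball 0 ϱ)`) exercised in kernel on a toy whose non-affinity is a THEOREM — nothing about Bałaban's dressings, which the tree
displays only along pencils; (B1b) by definition of the toy activity; (B3) met because the weight is CHOSEN — G-ne9p2-5 UNPRINTED for Bałaban's cores; 0
binders instantiated on Bałaban's densities; no wall item; wall v1.7 (T4-DAG v43) does NOT move».

HONEST FRAMING (c3∕c4∕c6∕k1–k3; wording = INTENT l.18402 + the rider above).  A WITNESS: it exercises the
owner's two CURVE-form cores ENDs (N0p §4 with (B3) as the exact-mass binder `hL3`, N0q §2 with (B3) as the letter budget `hM3`) on W33's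
ONE decided `BiCore` over row NE5's TOY frame with NE5's DECOUPLED toy letters, along OUR decided non-affine curve — a THEOREM-backed
instance of the FORMAT of record, NOT Bałaban's (2.14) terms, NOT rows NE2∕NE3's Gaussian data, NOT the substrate's `slotsOfRecord`, NOT
any fluctuation covariance of print; `s²∕2`, `½`, `2`, `3∕2`, `9∕4`, `√(2π)` are OUR toy arithmetic — no numeral of [Balaban1988RGII]; the
located «sup over the disc» is a statement about the SHAPE of N0p∕N0q's binders `hR`∕`hL3`∕`hM3`, not about print; (B1b) by definition
of the toy activity; (B3) = G-ne9p2-5 stays UNPRINTED for Bałaban's cores — `hM3`∕`hL3` are met because W35's∕W33's weights are CHOSEN,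
a letter-level DISPLAY, not a discharge; (B5)∕geometry-for-Bałaban's-densities∕step-link DISPLAYED elsewhere, untouched; 0 binders
instantiated on Bałaban's densities; no wall item; wall v1.7 (T4-DAG v43) does NOT move; R-t4r2-Q2 NOT met thereby; NE1′ ⇐ the named
binders — NOT proved, NOT printed; spine PROVED 0∕9; count 9 unchanged.  Every constant is W24's ∕ pv22's located torus letter
(`A = (e·K₀(64,8)·9·64)⁻¹`, `ν = 9`, `c₁ = 64`, `κ₀ = 64·log 162`), W33's ∕ W35's toy letters (`r`, `cW`, `cM`, `ϱ = 2`, class radii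
`(1, 2)`) or Mathlib's; [decided toy] ∕ [folklore] ∕ [arith]; no placeholders; no citations (bracketed names are labels); no
internally-minted statement becomes a cited fact (ABSOLUTE RULE).  Rung (B)+1 on ONE finite four-torus — NOT infinite volume, NOT a mass
gap, NOT OS on ℝ⁴, NOT Clay.  HONEST DEPENDENCY: continuum YM on T⁴ ⇐ BetaPertH ∧ nine spine estimates (0/9 proved); BetaPertH ⇐ (D1) ∧
(D4) ∧ CAP+tail; G-an2-4 gates asym, D1 and NE2/3/4.
-/

noncomputable section

namespace Summit.QuantumFields.BalabanUV.T4Continuum.NE1p.DressedSmallFieldCurveWitness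

open Set Metric MeasureTheory Complex
open scoped BigOperators
open Literature.MathematicalPhysics.QuantumFieldTheory.Balaban1983to89
open Literature.MathematicalPhysics.QuantumFieldTheory.Balaban1983to89.B12TreeDecay (K₀ K₀_pos)
open Literature.MathematicalPhysics.QuantumFieldTheory.Balaban1983to89.B13Resummation (locE)
open Literature.MathematicalPhysics.QuantumFieldTheory.Balaban1983to89.TreeLengthTorus (TDom tsys torusTreeLen torusTreeLen_singleton)
open Literature.MathematicalPhysics.QuantumFieldTheory.Balaban1983to89.TreeLengthTorusGeometry (tgeometry TTouch)
open Literature.MathematicalPhysics.QuantumFieldTheory.Balaban1983to89.T4InputCauchyRateSpecies (ballClass)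
open Summit.QuantumFields.BalabanUV.T4Continuum.B13HistMeasurable (B13HistM)
open Summit.QuantumFields.BalabanUV.T4Continuum.B13HistReadout (VppCLMM VppCLMM_apply)
open Summit.QuantumFields.BalabanUV.T4Continuum.B13HistWitness (toyFrame)
open Summit.QuantumFields.BalabanUV.T4Continuum.B13TermParamGaussianBi (BiCore termBi)
open Summit.QuantumFields.BalabanUV.T4Continuum.NE1p.DressedSmallFieldTorusWitness (X₀ X₀_val eq_X₀_iff hrate_torus exp_locE_cube)
open Summit.QuantumFields.BalabanUV.T4Continuum.NE1p.DressedSmallFieldGeometry (torus_consts)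
open Summit.QuantumFields.BalabanUV.T4Continuum.NE1p.DressedSmallFieldGeometryFaces (K₀_four)
open Summit.QuantumFields.BalabanUV.T4Continuum.NE1p.DressedSmallFieldCoresWitness (E1 crd liveTable VppM_liveTable
  norm_liveTable_le coreW coreFam N₁_coreW ctr0 hroom0 Acst Acst_pos cW cW_pos termsW termsW_X₀ actW hL3_W hsmall_W termBi_coreFam
  incr integral_incr_pos integrable_term norm_actW_X₀_lt_one)
open Summit.QuantumFields.BalabanUV.T4Continuum.NE1p.DressedSmallFieldCoresMassWitness (letterMass_coreW cM cM_pos actM hM3_M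
  coresMuEnd_live)
open Summit.QuantumFields.BalabanUV.T4Continuum.NE1p.DressedSmallFieldOnCores (attachedPart_locE_le_of_cores)
open Summit.QuantumFields.BalabanUV.T4Continuum.NE1p.DressedSmallFieldOnCoresMass (attachedPart_locE_le_of_cores_mass)

/-! ## §1 The decided NON-AFFINE table curve and the activity read along it (toy DATA) -/

/-- **THE CURVE** (toy DATA) [decided toy]: `hcQ s := 0 + (s²∕2) • liveTable` — a holomorphic, NON-AFFINE dressing of the undressed table
`0` reaching the HALF-strength table `½ • liveTable` at `s = 1`; written `0 + _ • liveTable` so that W33∕W35's closed forms apply by `rfl`.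
[folklore] -/
def hcQ (s : ℂ) : B13HistM toyFrame := (0 : B13HistM toyFrame) + (s ^ 2 / 2) • liveTable

/-- `hcQ` is complex differentiable (a polynomial times a fixed vector). [folklore] -/
theorem differentiable_hcQ : Differentiable ℂ hcQ :=
  (differentiable_const _).add (((differentiable_id.pow 2).div_const 2).smul_const _)

/-- Endpoints: `hcQ 0 = 0`. [folklore] -/
@[simp] theorem hcQ_zero : hcQ 0 = 0 := by simp [hcQ]

/-- Endpoints: `hcQ 1 = ½ • liveTable` — HALF table strength. [folklore] -/
theorem hcQ_one : hcQ 1 = (2 : ℂ)⁻¹ • liveTable := by simp [hcQ, div_eq_mul_inv]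

/-- On the disc `‖s‖ < 2` the curve has table radius `‖hcQ s‖ ≤ 2‖liveTable‖` (`‖s‖²∕2 < 2`). [folklore] -/
theorem norm_hcQ_le {s : ℂ} (hs : s ∈ ball (0 : ℂ) 2) : ‖hcQ s‖ ≤ 2 * ‖liveTable‖ := by
  rw [mem_ball_zero_iff] at hs
  unfold hcQ
  rw [zero_add, norm_smul, norm_div, norm_pow, Complex.norm_two]
  have h4 : ‖s‖ ^ 2 ≤ 4 := by nlinarith [norm_nonneg s]
  exact mul_le_mul_of_nonneg_right (by linarith) (norm_nonneg _)

/-- … hence `‖hcQ s‖ ≤ ‖0‖ + 2‖liveTable‖` — LITERALLY the growth radius at which W35's `hM3_M` reads (B3). [folklore] -/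
theorem norm_hcQ_le' {s : ℂ} (hs : s ∈ ball (0 : ℂ) 2) : ‖hcQ s‖ ≤ ‖(0 : B13HistM toyFrame)‖ + 2 * ‖liveTable‖ := by
  rw [norm_zero, zero_add]; exact norm_hcQ_le hs

/-- … and `‖hcQ s‖ ≤ 2`: the curve stays in NE5's ball class of history radius `2` (`‖liveTable‖ ≤ 1`). [folklore] -/
theorem norm_hcQ_le_two {s : ℂ} (hs : s ∈ ball (0 : ℂ) 2) : ‖hcQ s‖ ≤ 2 :=
  (norm_hcQ_le hs).trans (by linarith [norm_liveTable_le])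

section Torus
variable (N : ℕ) [NeZero N] (r : ℝ) (hr : 0 ≤ r)

/-- THE ACTIVITY READ ALONG THE CURVE (toy DATA): the sum of the terms of W33's core family at W35's weight `cM r` with the table `hcQ s` —
BY DEFINITION (`hact`∕`hscale` by `rfl`). [folklore] -/
def actQ (k : ℕ) (s : ℂ) (Z : TDom 4 N) : ℂ :=
  ∑ i ∈ termsW N Z, termBi (coreFam (cM r) r hr) k i (0 : ℂ) (hcQ s) k

/-- **THE CURVE READS W35's PENCIL AT THE SQUARED-HALVED PARAMETER**: `actQ k s = actM k (s²∕2)` — `rfl`. [folklore] -/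
theorem actQ_eq_actM (k : ℕ) (s : ℂ) (Z : TDom 4 N) : actQ N r hr k s Z = actM N r hr k (s ^ 2 / 2) Z := rfl

/-- At `s = 0` the curve's activity is the undressed one: `actQ k 0 = actM k 0`. [folklore] -/
theorem actQ_zero (k : ℕ) (Z : TDom 4 N) : actQ N r hr k 0 Z = actM N r hr k 0 Z := by
  rw [actQ_eq_actM]; norm_num

/-- At `s = 1` the curve's activity is W35's pencil activity at the REAL source `½`: `actQ k 1 = actM k ↑(1∕2 : ℝ)`. [folklore] -/
theorem actQ_one (k : ℕ) (Z : TDom 4 N) : actQ N r hr k 1 Z = actM N r hr k ((1 / 2 : ℝ) : ℂ) Z := by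
  rw [actQ_eq_actM]; push_cast; norm_num

/-! ## §2 THE END FIRES: N0q's curve-form cores END `attachedPart_locE_le_of_cores_mass` applied ONCE BY NAME -/

open Classical in
/-- **N0q's CURVE-FORM CORES END FIRES ALONG THE NON-AFFINE CURVE** [decided toy]:
`attachedPart_locE_le_of_cores_mass (tsys 4 N) (tgeometry 4 N) (coreFam (cM r) r hr)` with W33's `hroom0`∕`ctr0`, NE5's toy letters
`(mq, bq, N₀) = (1, 0, 1)` discharged INLINE in the literal binder shapes (W33∕W35 pattern), the CURVE data `hcurve := differentiable_hcQ`,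
`hK` (class membership along the whole disc `‖s‖ < 2`), `hR` at the growth radius `R₀ := ‖0‖ + 2‖liveTable‖`, `hscale`∕`hact` by `rfl`,
W24's `hrate_torus`, W33's `hsmall_W`, W35's `hM3_M` (UNCHANGED — the curve has the pencil's growth radius), `hϱ : 2 ≤ 2`, `hϱA`.
Conclusion LITERAL.  Nothing of Bałaban's densities. [folklore] -/
theorem curveEnd_fires (k : ℕ) :
    ‖locE (tgeometry 4 N).ι (tgeometry 4 N).cubes (actQ N r hr k 1) ((tgeometry 4 N).cubes (X₀ N)) -
        locE (tgeometry 4 N).ι (tgeometry 4 N).cubes (actQ N r hr k 0) ((tgeometry 4 N).cubes (X₀ N))‖ ≤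
      4 * (Real.exp 1 * (tgeometry 4 N).ν * (tgeometry 4 N).c₁ * (tgeometry 4 N).K₀ ^ 2) * (Acst / 2) *
        Real.exp (-(0 * (tsys 4 N).dj (X₀ N))) :=
  attachedPart_locE_le_of_cores_mass (tsys 4 N) (tgeometry 4 N) (coreFam (cM r) r hr)
    (W := Set.univ) (ctr := ctr0) (ROp := fun _ => 1) (RHist := fun _ => 2) (R' := fun _ => 2)
    (mq := fun _ _ _ => 1) (bq := fun _ _ _ => 0) (N₀ := fun _ _ _ => 1)
    hroom0 (fun _ _ _ _ _ _ _ => one_pos)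
    (fun _ _ _ _ _ _ _ => ⟨fun _ _ => aestronglyMeasurable_const, fun _ => differentiableOn_const _, fun _ _ _ => by
      show ‖(1 : ℂ)‖ ≤ 1; rw [norm_one]⟩)
    (fun _ _ _ _ _ _ _ => ⟨fun _ _ => (Complex.measurable_ofReal.comp (measurable_snd.norm.pow_const 2)).aestronglyMeasurable,
      fun _ _ => differentiableOn_const _, fun _ _ _ v => by show 1 * ‖v‖ ^ 2 - 0 ≤ (((‖v‖ ^ 2 : ℝ) : ℂ)).re; rw [Complex.ofReal_re]; simp⟩)
    (g := fun _ => 0) (Set.mem_univ _) (U := ()) (o := 0) (hc := hcQ) (ϱ := 2) (R₀ := ‖(0 : B13HistM toyFrame)‖ + 2 * ‖liveTable‖)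
    differentiable_hcQ.differentiableOn
    (fun s hs => Set.mk_mem_prod (mem_closedBall.2 (by show dist (0 : ℂ) 0 ≤ 1; simp))
      (mem_closedBall.2 (by show dist (hcQ s) 0 ≤ 2; rw [dist_zero_right]; exact norm_hcQ_le_two hs)))
    (fun s hs => norm_hcQ_le' hs)
    (emb := fun _ => k) (fun _ => rfl) (terms := termsW N) (act := actQ N r hr k) (fun _ _ _ => rfl)
    (A₀ := 0) (A₁ := Acst / 2) (R := 2 * (tgeometry 4 N).κ₀ + 2) (r₁ := 0) (b₅ := 0) (X₀ := X₀ N)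
    le_rfl (by have := Acst_pos; positivity) le_rfl (by norm_num) (hrate_torus N) (hsmall_W N) (hM3_M N r hr k _)
    le_rfl (by have := Acst_pos; linarith)

open Classical in
/-- … in CLOSED FORM: `≤ 2·K₀(64,8)` (pv22's located constants `ν = 9`, `c₁ = 64`, `K₀ = K₀(64,8)` BY NAME;
`4·(e·9·64·K₀²)·(A∕2)·e⁰` with `A = (e·K₀·9·64)⁻¹`). [folklore] -/
theorem curveEnd_fires_closed (k : ℕ) :
    ‖locE (tgeometry 4 N).ι (tgeometry 4 N).cubes (actQ N r hr k 1) ((tgeometry 4 N).cubes (X₀ N)) -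
        locE (tgeometry 4 N).ι (tgeometry 4 N).cubes (actQ N r hr k 0) ((tgeometry 4 N).cubes (X₀ N))‖ ≤ 2 * K₀ 64 8 := by
  refine (curveEnd_fires N r hr k).trans (le_of_eq ?_)
  rw [(torus_consts N).1, (torus_consts N).2.2, K₀_four, zero_mul, neg_zero, Real.exp_zero, mul_one]
  unfold Acst
  have hK := K₀_pos (64 : ℝ) 8
  have he := Real.exp_pos 1
  field_simp
  ring

end Torus

/-! ## §3 IN KERNEL: the curve is NO pencil — the curve-form END states here what no pencil END can state -/

/-- W33's live table is NOT the zero table: its `V″`-entry at `(0, 0)` is `e⁰ = 1` (`VppM_liveTable`), while the bounded linear read-out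
`VppCLMM` kills `0`. [folklore] -/
theorem liveTable_ne_zero : liveTable ≠ 0 := by
  intro h
  have h1 := VppCLMM_apply toyFrame (0 : ℕ) (0 : ℝ) liveTable
  rw [VppM_liveTable, h, map_zero] at h1
  have h2 : (Real.exp (-((0 : ℝ) ^ 2)) : ℂ) = 0 := h1.symm
  exact (Real.exp_pos _).ne' (by exact_mod_cast h2)

/-- **THE CURVE IS NOT A PENCIL ON THE DISC** [decided toy]: no `h₀`, `w` with `hcQ s = h₀ + s • w` for all `‖s‖ < 2` — evaluate at
`s = 0, 1, −1`: `h₀ = 0`, `w = ½ • liveTable = −w`, so `liveTable = 0`, absurd.  Hence none of the PENCIL ENDs (N0p `…_cores_pencil`, N0q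
`…_cores_pencil_mass`, N0r §2∕§3) can even state §2's inequality; only the curve form can. [folklore] -/
theorem hcQ_not_pencil : ¬ ∃ h₀ w : B13HistM toyFrame, ∀ s ∈ ball (0 : ℂ) 2, hcQ s = h₀ + s • w := by
  rintro ⟨h₀, w, h⟩
  -- read the pencil identity through the bounded linear functional `V″(·)(0, 0)`, which sends `liveTable ↦ e⁰ = 1`
  have key := fun s hs => congrArg (VppCLMM toyFrame (0 : ℕ) (0 : ℝ)) (h s hs)
  have e0 := key 0 (mem_ball_self two_pos)
  have e1 := key 1 (by rw [mem_ball_zero_iff, norm_one]; norm_num)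
  have em := key (-1) (by rw [mem_ball_zero_iff, norm_neg, norm_one]; norm_num)
  simp only [hcQ, map_add, map_smul, smul_eq_mul, zero_add, VppCLMM_apply, VppM_liveTable] at e0 e1 em
  -- scalar identities in `ℂ`: `s²/2 · e⁰ = a + s · b` at `s = 0, 1, −1`
  have hexp : ((Real.exp (-((0 : ℝ) ^ 2)) : ℝ) : ℂ) = 1 := by simp
  rw [hexp] at e0 e1 em
  have h10 : (1 : ℂ) = 0 := by linear_combination e1 + em - 2 * e0
  exact one_ne_zero h10

/-- … in particular the curve is not W35's pencil `s ↦ 0 + s • liveTable` (they differ at `s = 1`). [folklore] -/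
theorem hcQ_ne_pencil : hcQ ≠ fun s => (0 : B13HistM toyFrame) + s • liveTable := by
  intro h
  exact hcQ_not_pencil ⟨0, liveTable, fun s _ => congrFun h s⟩

/-! ## §4 GENUINE: the END's bounded quantity is NOT zero — the curve's endpoint is the half-strength table -/

section Live
variable (N : ℕ) [NeZero N] (r : ℝ) (hr : 0 ≤ r)

open Classical in
/-- **THE ATTACHED PART ALONG THE CURVE IS NOT ZERO** [decided toy]: `actQ k 1 = actM k ½`, `actQ k 0 = actM k 0`, and W35's
`coresMuEnd_live` at the REAL source `t = ½` (`0 < ½ ≤ 2`; W24's `exp_locE_cube` inside) BY NAME. [folklore] -/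
theorem curveEnd_live (hr0 : 0 < r) (k : ℕ) :
    locE (tgeometry 4 N).ι (tgeometry 4 N).cubes (actQ N r hr k 1) ((tgeometry 4 N).cubes (X₀ N)) ≠
      locE (tgeometry 4 N).ι (tgeometry 4 N).cubes (actQ N r hr k 0) ((tgeometry 4 N).cubes (X₀ N)) := by
  have h1 : actQ N r hr k 1 = actM N r hr k ((1 / 2 : ℝ) : ℂ) := funext fun Z => actQ_one N r hr k Z
  have h0 : actQ N r hr k 0 = actM N r hr k 0 := funext fun Z => actQ_zero N r hr k Z
  rw [h1, h0]
  exact coresMuEnd_live N r hr hr0 (by norm_num) (by norm_num) k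

end Live

/-! ## §5 LOCATED: the curve-form END charges (B3)'s growth letter at the SUP of the curve over the disc, not at its endpoint -/

/-- **THE LETTER CLAUSE PINS THE GROWTH RADIUS** [arith]: at W35's weight `cM r = A·e^{−2r}∕√(2π)` and W33's core (`λ(univ) = 1`,
`wB = |cM r|`, `N₁ = r`, toy letters `(1, 0, 1)`), the (B3) letter clause at `X₀` with growth radius `R₀`,
`|cM r|·√(2π)·e^{r·R₀} ≤ A`, holds IFF `R₀ ≤ 2` (for `0 < r`). [folklore] -/
theorem letterClause_iff {r : ℝ} (hr0 : 0 < r) (R₀ : ℝ) :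
    (coreW (cM r) r hr0.le).lam.real univ * ((coreW (cM r) r hr0.le).wB * (1 : ℝ) * Real.exp (0 : ℝ)) *
        (Real.pi / ((1 : ℝ) / 2)) ^ (Module.finrank ℝ E1 / 2 : ℝ) * Real.exp ((coreW (cM r) r hr0.le).N₁ * R₀) ≤ Acst ↔
      R₀ ≤ 2 := by
  rw [letterMass_coreW, N₁_coreW, abs_of_pos (cM_pos r)]
  have h2π : 0 < Real.sqrt (2 * Real.pi) := Real.sqrt_pos.2 (by positivity)
  unfold cM
  rw [div_mul_cancel₀ _ h2π.ne', mul_assoc, ← Real.exp_add]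
  constructor
  · intro h
    have h' : Real.exp (-(2 * r) + r * R₀) ≤ 1 := le_of_mul_le_mul_left (by rwa [mul_one]) Acst_pos
    rw [Real.exp_le_one_iff] at h'
    nlinarith
  · intro h
    calc Acst * Real.exp (-(2 * r) + r * R₀) ≤ Acst * Real.exp 0 := by
          gcongr
          · exact Acst_pos.le
          · nlinarith
      _ = Acst := by rw [Real.exp_zero, mul_one]

/-- **THE SUP IS WHAT IS CHARGED** [decided toy]: the curve's table radius bound `2‖liveTable‖` (`norm_hcQ_le`) is SHARP on the disc — for
every `ε > 0` some `s` with `‖s‖ < 2` has `‖hcQ s‖ > 2‖liveTable‖ − ε` — although the END only compares the endpoint tables `hcQ 1 = ½ •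
liveTable` and `hcQ 0 = 0`: N0q's `hR`∕`hM3` read the growth letter `e^{N₁R₀}` at `R₀ ≥ sup_{‖s‖<ϱ} ‖hc s‖` over the WHOLE disc
(`ϱ ≥ 2` forced by N0m's `hϱ`). [folklore] -/
theorem norm_hcQ_sharp {ε : ℝ} (hε : 0 < ε) : ∃ s ∈ ball (0 : ℂ) 2, 2 * ‖liveTable‖ - ε < ‖hcQ s‖ := by
  -- take the real parameter `t := 2 − δ`, `δ := min 1 (ε / 4)`:
  -- `‖hcQ t‖ = (t²/2)‖liveTable‖ ≥ (2 − 2δ)‖liveTable‖ ≥ 2‖liveTable‖ − 2δ > 2‖liveTable‖ − ε`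
  set δ : ℝ := min 1 (ε / 4) with hδ
  have hδ0 : 0 < δ := lt_min one_pos (by linarith)
  have hδ1 : δ ≤ 1 := min_le_left _ _
  have hδε : δ ≤ ε / 4 := min_le_right _ _
  have hT : ‖liveTable‖ ≤ 1 := norm_liveTable_le
  refine ⟨((2 - δ : ℝ) : ℂ), ?_, ?_⟩
  · rw [mem_ball_zero_iff, Complex.norm_real, Real.norm_eq_abs, abs_of_pos (by linarith)]; linarith
  · unfold hcQ
    rw [zero_add, norm_smul, norm_div, norm_pow, Complex.norm_real, Complex.norm_two, Real.norm_eq_abs, abs_of_pos (by linarith)]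
    have hsq : 2 - 2 * δ ≤ (2 - δ) ^ 2 / 2 := by nlinarith
    have hT0 : 0 ≤ ‖liveTable‖ := norm_nonneg _
    nlinarith [mul_le_mul_of_nonneg_right hsq hT0]

/-- **THE FULL-STRENGTH CURVE BREAKS THE PENCIL's RADIUS BINDER** [decided toy]: the curve `s ↦ 0 + s² • liveTable` (endpoint `liveTable`, as
W33∕W35's pencil) leaves the table radius `‖0‖ + 2‖liveTable‖` inside the disc — at `s = 3∕2` its table has norm `(9∕4)‖liveTable‖` — so
N0q's `hR` at W35's growth radius FAILS for it (mutant M1); by `letterClause_iff` its admissible growth radius `4` needs a weight with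
`e^{−4r}`, i.e. W35's `cM (2r)`, not `cM r` — SAID, not built. [folklore] -/
theorem fullCurve_exceeds_radius :
    ∃ s ∈ ball (0 : ℂ) 2, ‖(0 : B13HistM toyFrame)‖ + 2 * ‖liveTable‖ < ‖(0 : B13HistM toyFrame) + s ^ 2 • liveTable‖ := by
  have hT : 0 < ‖liveTable‖ := norm_pos_iff.2 liveTable_ne_zero
  refine ⟨((3 / 2 : ℝ) : ℂ), ?_, ?_⟩
  · rw [mem_ball_zero_iff, Complex.norm_real, Real.norm_eq_abs]; norm_num
  · rw [norm_zero, zero_add, zero_add, norm_smul, norm_pow, Complex.norm_real, Real.norm_eq_abs,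
      abs_of_pos (by norm_num : (0 : ℝ) < 3 / 2)]
    nlinarith

/-! ## §6 THE `hL3`-TWIN: N0p §4's curve-form cores END `attachedPart_locE_le_of_cores` on the SAME curve at W33's exact-mass weight -/

section ExactMass
variable (N : ℕ) [NeZero N] (r : ℝ) (hr : 0 ≤ r)

open Classical in
/-- **N0p §4's CURVE-FORM CORES END FIRES ALONG THE NON-AFFINE CURVE, (B3) AS THE EXACT-MASS BINDER `hL3`** [decided toy]:
`attachedPart_locE_le_of_cores (tsys 4 N) (tgeometry 4 N) (coreFam (cW r) r hr)` — the END N0p's own pencil corollary, N0q §2 and crew row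
S27's faces apply, never before with a non-affine `hc` — with the curve data `differentiable_hcQ` ∕ `hK` ∕ `hR` of §2 and W33's `hL3_W`
(growth radius `‖0‖ + 2‖liveTable‖`, UNCHANGED), `hsmall_W`, W24's `hrate_torus` BY NAME; toy letters INLINE; the activity is W33's own `actW`
read at the curve's parameter, `act := fun s => actW r hr N k (s²∕2)` (`hact` by `rfl`: `actW … (s²∕2)` unfolds to the core terms at the table
`hcQ s`) — no new datum.  Conclusion LITERAL (`act 1`, `act 0` displayed as `actW … (1²∕2)`, `actW … (0²∕2)`). [folklore] -/
theorem curveEndExact_fires (k : ℕ) :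
    ‖locE (tgeometry 4 N).ι (tgeometry 4 N).cubes (actW r hr N k (1 ^ 2 / 2)) ((tgeometry 4 N).cubes (X₀ N)) -
        locE (tgeometry 4 N).ι (tgeometry 4 N).cubes (actW r hr N k (0 ^ 2 / 2)) ((tgeometry 4 N).cubes (X₀ N))‖ ≤
      4 * (Real.exp 1 * (tgeometry 4 N).ν * (tgeometry 4 N).c₁ * (tgeometry 4 N).K₀ ^ 2) * (Acst / 2) *
        Real.exp (-(0 * (tsys 4 N).dj (X₀ N))) :=
  attachedPart_locE_le_of_cores (tsys 4 N) (tgeometry 4 N) (coreFam (cW r) r hr)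
    (W := Set.univ) (ctr := ctr0) (ROp := fun _ => 1) (RHist := fun _ => 2) (R' := fun _ => 2)
    (mq := fun _ _ _ => 1) (bq := fun _ _ _ => 0) (N₀ := fun _ _ _ => 1)
    hroom0 (fun _ _ _ _ _ _ _ => one_pos)
    (fun _ _ _ _ _ _ _ => ⟨fun _ _ => aestronglyMeasurable_const, fun _ => differentiableOn_const _, fun _ _ _ => by
      show ‖(1 : ℂ)‖ ≤ 1; rw [norm_one]⟩)
    (fun _ _ _ _ _ _ _ => ⟨fun _ _ => (Complex.measurable_ofReal.comp (measurable_snd.norm.pow_const 2)).aestronglyMeasurable,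
      fun _ _ => differentiableOn_const _, fun _ _ _ v => by show 1 * ‖v‖ ^ 2 - 0 ≤ (((‖v‖ ^ 2 : ℝ) : ℂ)).re; rw [Complex.ofReal_re]; simp⟩)
    (g := fun _ => 0) (Set.mem_univ _) (U := ()) (o := 0) (hc := hcQ) (ϱ := 2) (R₀ := ‖(0 : B13HistM toyFrame)‖ + 2 * ‖liveTable‖)
    differentiable_hcQ.differentiableOn
    (fun s hs => Set.mk_mem_prod (mem_closedBall.2 (by show dist (0 : ℂ) 0 ≤ 1; simp))
      (mem_closedBall.2 (by show dist (hcQ s) 0 ≤ 2; rw [dist_zero_right]; exact norm_hcQ_le_two hs)))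
    (fun s hs => norm_hcQ_le' hs)
    (emb := fun _ => k) (fun _ => rfl) (terms := termsW N) (act := fun s => actW r hr N k (s ^ 2 / 2)) (fun _ _ _ => rfl)
    (A₀ := 0) (A₁ := Acst / 2) (R := 2 * (tgeometry 4 N).κ₀ + 2) (r₁ := 0) (b₅ := 0) (X₀ := X₀ N)
    le_rfl (by have := Acst_pos; positivity) le_rfl (by norm_num) (hrate_torus N) (hsmall_W N) (hL3_W r hr N k _)
    le_rfl (by have := Acst_pos; linarith)

/-- **W33's INCREMENT AT A REAL SOURCE `t` IN CLOSED FORM** [decided toy]: `actW t X₀ − actW 0 X₀ = cW·∫ incr (t·r)` (W35's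
`actM_real_sub_zero`, proof verbatim at W33's weight; W33 states the case `t = 1` only). [folklore] -/
theorem actW_real_sub_zero (k : ℕ) (t : ℝ) :
    actW r hr N k (t : ℂ) (X₀ N) - actW r hr N k 0 (X₀ N) = (cW r : ℂ) * ((∫ v, incr (t * r) v : ℝ) : ℂ) := by
  unfold actW
  rw [termsW_X₀, Finset.sum_singleton, Finset.sum_singleton, termBi_coreFam, termBi_coreFam, ← mul_sub,
    ← integral_sub (integrable_term r hr (t : ℂ)) (integrable_term r hr 0), ← integral_complex_ofReal]
  congr 1
  refine integral_congr_ae (Filter.Eventually.of_forall fun v => ?_)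
  simp only [incr, zero_mul, Complex.exp_zero]
  push_cast
  ring_nf

/-- W33's activity at a REAL positive source differs from the undressed one (`cW > 0`, `∫ incr (t·r) > 0`). [folklore] -/
theorem actW_real_live (hr0 : 0 < r) {t : ℝ} (ht : 0 < t) (k : ℕ) : actW r hr N k (t : ℂ) (X₀ N) ≠ actW r hr N k 0 (X₀ N) := by
  intro h
  have h0 := sub_eq_zero.2 h
  rw [actW_real_sub_zero] at h0
  rcases mul_eq_zero.1 h0 with hc | hI
  · exact (cW_pos r).ne' (by exact_mod_cast hc)
  · exact (integral_incr_pos (t * r) (mul_pos ht hr0)).ne' (by exact_mod_cast hI)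

open Classical in
/-- **THE `hL3`-TWIN's BOUNDED QUANTITY IS NOT ZERO** [decided toy]: `1²∕2 = ½`, `0²∕2 = 0`, W24's `exp_locE_cube` and W33's `norm_actW_X₀_lt_one` BY
NAME, then `actW_real_live` at `t = ½`. [folklore] -/
theorem curveEndExact_live (hr0 : 0 < r) (k : ℕ) :
    locE (tgeometry 4 N).ι (tgeometry 4 N).cubes (actW r hr N k (1 ^ 2 / 2)) ((tgeometry 4 N).cubes (X₀ N)) ≠
      locE (tgeometry 4 N).ι (tgeometry 4 N).cubes (actW r hr N k (0 ^ 2 / 2)) ((tgeometry 4 N).cubes (X₀ N)) := by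
  have h1 : ((1 : ℂ) ^ 2 / 2) = ((1 / 2 : ℝ) : ℂ) := by push_cast; norm_num
  have h0 : ((0 : ℂ) ^ 2 / 2) = 0 := by norm_num
  rw [h1, h0]
  intro h
  have hh : ‖((1 / 2 : ℝ) : ℂ)‖ ≤ 1 := by rw [Complex.norm_real, Real.norm_eq_abs]; norm_num
  have e1 := exp_locE_cube N (w := actW r hr N k ((1 / 2 : ℝ) : ℂ)) (norm_actW_X₀_lt_one r hr N hr0 k hh)
  have e0 := exp_locE_cube N (w := actW r hr N k 0) (norm_actW_X₀_lt_one r hr N hr0 k (by simp))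
  have h' : cexp (locE (TTouch (d := 4) (N := N)) (fun Z : (tsys 4 N).Dom => Z.1) (actW r hr N k ((1 / 2 : ℝ) : ℂ)) {0}) =
      cexp (locE (TTouch (d := 4) (N := N)) (fun Z : (tsys 4 N).Dom => Z.1) (actW r hr N k 0) {0}) := congrArg cexp h
  rw [e1, e0, add_right_inj] at h'
  exact actW_real_live N r hr hr0 (by norm_num : (0 : ℝ) < 1 / 2) k h'

end ExactMass

end Summit.QuantumFields.BalabanUV.T4Continuum.NE1p.DressedSmallFieldCurveWitness

end
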